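import Literature.MathematicalPhysics.QuantumLattice.HubbardSectorGridOverlap
import Literature.MathematicalPhysics.QuantumLattice.HubbardSpaceTimeCharacters
import HarnessLib

/-!
# The overlap kernel `E_F S_{4M}` is translation invariant: its row and column sizes are the origin-row size

Topic `MathematicalPhysics/QuantumLattice`; continuation of `HubbardSectorGridOverlap.lean`.  There the row and column sums of
`‖E_F S‖` (sector analysis on the dual time lattice `SpaceTimeIdx L M` after the substitution of the fields on the `N`-point
time grid) were reduced to the `ℓ¹` sizes of one cross-grid multiplier kernel at a FIXED row `(y, ((ω,σ),c))` resp. a fixed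
column `((q,σ),c)`.  Here, for the grid of the ultraviolet step, `N = 4M` (twice as fine as the dual lattice `2M`), the
dependence on the fixed leg is removed (Benfatto–Giuliani–Mastropietro 2006, (2.71a): the sector kernels `F̌_{h,ω}(x - y)`
depend on the difference of the points only; Salmhofer 1999, §4.2.4: the time lattice):

* `exp_matsubara_crossGrid_phase_eq` — the fermionic time phase between a dual-lattice time `jβ/(2M)` and a grid time `j'β/(4M)`
  is the `ℤ/4Mℤ`-character `χ_i(j' - 2j)` times a unimodular factor that does not depend on the frequency index `i`
  (cross-grid twin of `HubbardSpaceTimeCharacters.exp_matsubara_phase_eq`);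
* `sectorAnalysis_mul_hubbardGridSub_apply_eq_char` — `(E_F S)((y,((ω,σ),c)),((q,σ),c)) = (βL²)⁻¹ · u · Σ_k F_ω(k) Χ_c(k; q₀ - 2y₀, q⃗ - y⃗)`
  with `Χ_0 = χ^{(4M)}_{k₀} ⊗ χ_{k⃗}`, `Χ_1 = conj Χ_0`, `‖u‖ = 1`: a function of the DIFFERENCE `(q₀ - 2y₀ mod 4M, q⃗ - y⃗)` on the
  product torus `(ℤ/4Mℤ) × (ℤ/Lℤ)²`;
* `norm_sectorAnalysis_mul_hubbardGridSub_apply` — hence `‖(E_F S)(y-row, q-column)‖ = (|β|L²)⁻¹ ‖Σ_k F_ω(k) Χ_c(k; q₀ - 2y₀, q⃗ - y⃗)‖`;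
* **`rowSum_norm_sectorAnalysis_mul_hubbardGridSub_eq`** — every row sum `Σ_q ‖(E_F S)((y,ℓ),((q,σ),c))‖` equals the product-torus
  sum `(|β|L²)⁻¹ Σ_{(d,w)} ‖Σ_k F_ω(k) Χ_c(k; d, w)‖`, independently of `y` (the grid column index runs over a translate of the
  whole product torus);
* **`colSum_norm_sectorAnalysis_mul_hubbardGridSub_le`** — every column sum `Σ_y ‖(E_F S)((y,((ω,σ),c)),((q,σ),c))‖` is AT MOST that
  product-torus sum (the dual lattice `y₀ ↦ 2y₀` is only half of `ℤ/4Mℤ`);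
* `rowSum_sectorAnalysis_mul_hubbardGridSub_le_of_torusSum`, `colSum_sectorAnalysis_mul_hubbardGridSub_le_of_torusSum` — the
  `cr`/`cc` hypotheses of the representation theorems from ONE bound `T` on the product-torus sums (per sector), `cr ≤ T`,
  `cc ≤ N_sectors · T`.

Everything is proved; no definitions, no named facts.

## Sources

G. Benfatto, A. Giuliani, V. Mastropietro, Ann. Henri Poincaré 7 (2006) 809–898 = arXiv:cond-mat/0507686, §2.1 (2.5), §2.7
(2.70)–(2.71a) [`BenfattoGiulianiMastropietro2006`]; M. Salmhofer, *Renormalization* (1999), §4.2.4 (4.55)–(4.63)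
[`Salmhofer1999`].
-/

noncomputable section

namespace Literature.MathematicalPhysics.QuantumLattice

open Finset Complex Literature.Probability.LatticeModels
open scoped Real ComplexConjugate

variable {L M : ℕ} [NeZero L] {N : ℕ}

/-! ### The cross-grid time phase as a `ℤ/4Mℤ` character -/

/-- **The fermionic phase between a dual-lattice time and a grid time is a `ℤ/4Mℤ`-character up to a frequency-independent
unimodular factor**: `e^{iω_i (τ_{j'} - t_j)} = χ_i(j' - 2j) · e^{iπ(1-2M)(j'-2j)/(4M)}`, `τ_{j'} = j'β/(4M)`, `t_j = jβ/(2M)`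
(`β ≠ 0`). [cite: Salmhofer1999, §4.2.4 (4.55)–(4.63)] -/
theorem exp_matsubara_crossGrid_phase_eq [NeZero M] {β : ℝ} (hβ : β ≠ 0) (i : MatsubaraIdx M) (j' : Fin (2 * (2 * M)))
    (j : ImagTimeIdx M) :
    Complex.exp (((matsubaraFreq β M i * (gridTime β (2 * (2 * M)) j' - imagTime β M j) : ℝ) : ℂ) * I) =
      torusChar (fun _ : Fin 1 => ((i : ℕ) : ZMod (2 * (2 * M))))
          (fun _ : Fin 1 => ((j' : ℕ) : ZMod (2 * (2 * M))) - 2 * ((j : ℕ) : ZMod (2 * (2 * M)))) *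
        Complex.exp (((π * (1 - 2 * M) * (((j' : ℕ) : ℝ) - 2 * ((j : ℕ) : ℝ)) / (2 * (2 * M)) : ℝ) : ℂ) * I) := by
  have hM : (M : ℂ) ≠ 0 := by exact_mod_cast NeZero.ne M
  have hβ' : (β : ℂ) ≠ 0 := by exact_mod_cast hβ
  rw [torusChar, Fin.prod_univ_one]
  have hcast : ((i : ℕ) : ZMod (2 * (2 * M))) * (((j' : ℕ) : ZMod (2 * (2 * M))) - 2 * ((j : ℕ) : ZMod (2 * (2 * M)))) =
      ((((i : ℕ) : ℤ) * (((j' : ℕ) : ℤ) - 2 * ((j : ℕ) : ℤ)) : ℤ) : ZMod (2 * (2 * M))) := by push_cast; ring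
  rw [hcast, ZMod.stdAddChar_coe, ← Complex.exp_add]
  congr 1
  simp only [matsubaraFreq, matsubaraInt, imagTime, gridTime]
  push_cast
  field_simp
  ring

/-! ### The overlap kernel as a function of the difference of the points -/

/-- **The overlap kernel in character form**: for `y` on the dual lattice and `q` on the `4M` grid,
`(E_F S)((y,((ω,σ),c)),((q,σ),c)) = (βL²)⁻¹ · u_c(q₀,y₀) · Σ_k F_ω(k) Χ_c(k; q₀ - 2y₀, q⃗ - y⃗)`, `Χ_0(k; d, w) = χ_{k₀}(d) χ_{k⃗}(w)`,
`Χ_1 = conj Χ_0`, `u_0 = e^{iπ(1-2M)(q₀-2y₀)/(4M)}`, `u_1 = conj u_0` (`β ≠ 0`). [cite: BenfattoGiulianiMastropietro2006, §2.7 (2.71)] -/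
theorem sectorAnalysis_mul_hubbardGridSub_apply_eq_char [NeZero M] {β : ℝ} (hβ : β ≠ 0) (F : Fin N → FreqMomentum L M → ℂ)
    (y : SpaceTimeIdx L M) (ω : Fin N) (σ c : Fin 2) (q : GridPoint L (2 * (2 * M))) :
    (sectorAnalysisMatrix L M β F * hubbardGridSub L M β (2 * (2 * M))) (y, ((ω, σ), c)) ((q, σ), c) =
      ((1 / (β * (L : ℝ) ^ 2) : ℝ) : ℂ) *
        ((if c = 0 then Complex.exp (((π * (1 - 2 * M) * (((q.1 : ℕ) : ℝ) - 2 * ((y.1 : ℕ) : ℝ)) / (2 * (2 * M)) : ℝ) : ℂ) * I)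
          else conj (Complex.exp (((π * (1 - 2 * M) * (((q.1 : ℕ) : ℝ) - 2 * ((y.1 : ℕ) : ℝ)) / (2 * (2 * M)) : ℝ) : ℂ) * I))) *
        ∑ k : FreqMomentum L M, F ω k *
          (if c = 0 then
              torusChar (fun _ : Fin 1 => ((k.1 : ℕ) : ZMod (2 * (2 * M))))
                  (fun _ : Fin 1 => ((q.1 : ℕ) : ZMod (2 * (2 * M))) - 2 * ((y.1 : ℕ) : ZMod (2 * (2 * M)))) *
                torusChar k.2 (q.2 - y.2)
            else
              conj (torusChar (fun _ : Fin 1 => ((k.1 : ℕ) : ZMod (2 * (2 * M))))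
                  (fun _ : Fin 1 => ((q.1 : ℕ) : ZMod (2 * (2 * M))) - 2 * ((y.1 : ℕ) : ZMod (2 * (2 * M)))) *
                torusChar k.2 (q.2 - y.2)))) := by
  rw [sectorAnalysis_mul_hubbardGridSub_apply, if_pos ⟨rfl, rfl⟩, mul_sum, mul_sum]
  refine sum_congr rfl fun k _ => ?_
  -- the phase of one momentum
  have hphase : hubbardPlaneWave L M β c k y * conj (vertexPlaneWave L M β c k q.2 (gridTime β (2 * (2 * M)) q.1)) =
      Complex.exp (((chargeSign c * (vertexPhase L M β k q.2 (gridTime β (2 * (2 * M)) q.1) - spaceTimePhase L M β k y) : ℝ) : ℂ) *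
        I) := by
    rw [hubbardPlaneWave, conj_vertexPlaneWave, ← Complex.exp_add]
    congr 1
    push_cast
    ring
  have hsplit : ((vertexPhase L M β k q.2 (gridTime β (2 * (2 * M)) q.1) - spaceTimePhase L M β k y : ℝ) : ℂ) * I =
      ((matsubaraFreq β M k.1 * (gridTime β (2 * (2 * M)) q.1 - imagTime β M y.1) : ℝ) : ℂ) * I +
        ((∑ j, latticeMomentum L k.2 j * (((q.2 j).val : ℝ) - ((y.2 j).val : ℝ)) : ℝ) : ℂ) * I := by
    rw [← add_mul, ← Complex.ofReal_add]
    congr 2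
    simp only [vertexPhase, spaceTimePhase]
    have : ∀ j, latticeMomentum L k.2 j * (((q.2 j).val : ℝ) - ((y.2 j).val : ℝ)) =
        latticeMomentum L k.2 j * ((q.2 j).val : ℝ) - latticeMomentum L k.2 j * ((y.2 j).val : ℝ) := fun j => by ring
    simp only [this, Finset.sum_sub_distrib]
    ring
  have h0 : Complex.exp (((vertexPhase L M β k q.2 (gridTime β (2 * (2 * M)) q.1) - spaceTimePhase L M β k y : ℝ) : ℂ) * I) =
      torusChar (fun _ : Fin 1 => ((k.1 : ℕ) : ZMod (2 * (2 * M))))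
          (fun _ : Fin 1 => ((q.1 : ℕ) : ZMod (2 * (2 * M))) - 2 * ((y.1 : ℕ) : ZMod (2 * (2 * M)))) *
        Complex.exp (((π * (1 - 2 * M) * (((q.1 : ℕ) : ℝ) - 2 * ((y.1 : ℕ) : ℝ)) / (2 * (2 * M)) : ℝ) : ℂ) * I) *
        torusChar k.2 (q.2 - y.2) := by
    rw [hsplit, Complex.exp_add, exp_matsubara_crossGrid_phase_eq hβ, exp_latticeMomentum_phase_eq_torusChar]
  by_cases hc : c = 0
  · subst hc
    have h1 : hubbardPlaneWave L M β 0 k y * conj (vertexPlaneWave L M β 0 k q.2 (gridTime β (2 * (2 * M)) q.1)) =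
        torusChar (fun _ : Fin 1 => ((k.1 : ℕ) : ZMod (2 * (2 * M))))
            (fun _ : Fin 1 => ((q.1 : ℕ) : ZMod (2 * (2 * M))) - 2 * ((y.1 : ℕ) : ZMod (2 * (2 * M)))) *
          Complex.exp (((π * (1 - 2 * M) * (((q.1 : ℕ) : ℝ) - 2 * ((y.1 : ℕ) : ℝ)) / (2 * (2 * M)) : ℝ) : ℂ) * I) *
          torusChar k.2 (q.2 - y.2) := by
      rw [hphase, ← h0]
      simp only [chargeSign, if_true, one_mul]
    simp only [if_true]
    calc F ω k * hubbardPlaneWave L M β 0 k y *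
          ((((1 / (β * (L : ℝ) ^ 2) : ℝ) : ℂ)) * conj (vertexPlaneWave L M β 0 k q.2 (gridTime β (2 * (2 * M)) q.1)))
        = (((1 / (β * (L : ℝ) ^ 2) : ℝ) : ℂ)) * (F ω k * (hubbardPlaneWave L M β 0 k y *
            conj (vertexPlaneWave L M β 0 k q.2 (gridTime β (2 * (2 * M)) q.1)))) := by ring
      _ = _ := by rw [h1]; ring
  · have hc1 : chargeSign c = -1 := by simp [chargeSign, hc]
    have hneg : ((((-1 : ℝ) * (vertexPhase L M β k q.2 (gridTime β (2 * (2 * M)) q.1) - spaceTimePhase L M β k y)) : ℝ) : ℂ) * I =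
        -((((vertexPhase L M β k q.2 (gridTime β (2 * (2 * M)) q.1) - spaceTimePhase L M β k y) : ℝ) : ℂ) * I) := by
      push_cast; ring
    have hconj : Complex.exp (-((((vertexPhase L M β k q.2 (gridTime β (2 * (2 * M)) q.1) - spaceTimePhase L M β k y) : ℝ) : ℂ) * I)) =
        conj (Complex.exp ((((vertexPhase L M β k q.2 (gridTime β (2 * (2 * M)) q.1) - spaceTimePhase L M β k y) : ℝ) : ℂ) * I)) := by
      rw [← Complex.exp_conj, map_mul, Complex.conj_ofReal, Complex.conj_I]
      ring_nf
    have h1 : hubbardPlaneWave L M β c k y * conj (vertexPlaneWave L M β c k q.2 (gridTime β (2 * (2 * M)) q.1)) =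
        conj (torusChar (fun _ : Fin 1 => ((k.1 : ℕ) : ZMod (2 * (2 * M))))
            (fun _ : Fin 1 => ((q.1 : ℕ) : ZMod (2 * (2 * M))) - 2 * ((y.1 : ℕ) : ZMod (2 * (2 * M))))) *
          conj (Complex.exp (((π * (1 - 2 * M) * (((q.1 : ℕ) : ℝ) - 2 * ((y.1 : ℕ) : ℝ)) / (2 * (2 * M)) : ℝ) : ℂ) * I)) *
          conj (torusChar k.2 (q.2 - y.2)) := by
      rw [hphase, hc1, hneg, hconj, h0, map_mul, map_mul]
    simp only [if_neg hc, map_mul]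
    calc F ω k * hubbardPlaneWave L M β c k y *
          ((((1 / (β * (L : ℝ) ^ 2) : ℝ) : ℂ)) * conj (vertexPlaneWave L M β c k q.2 (gridTime β (2 * (2 * M)) q.1)))
        = (((1 / (β * (L : ℝ) ^ 2) : ℝ) : ℂ)) * (F ω k * (hubbardPlaneWave L M β c k y *
            conj (vertexPlaneWave L M β c k q.2 (gridTime β (2 * (2 * M)) q.1)))) := by ring
      _ = _ := by rw [h1]; ring

/-- **The size of an overlap entry depends only on the difference of the points**:
`‖(E_F S)((y,((ω,σ),c)),((q,σ),c))‖ = (|β|L²)⁻¹ ‖Σ_k F_ω(k) Χ_c(k; q₀ - 2y₀, q⃗ - y⃗)‖`. [cite: BenfattoGiulianiMastropietro2006, §2.7 (2.71a)] -/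
theorem norm_sectorAnalysis_mul_hubbardGridSub_apply [NeZero M] {β : ℝ} (hβ : β ≠ 0) (F : Fin N → FreqMomentum L M → ℂ)
    (y : SpaceTimeIdx L M) (ω : Fin N) (σ c : Fin 2) (q : GridPoint L (2 * (2 * M))) :
    ‖(sectorAnalysisMatrix L M β F * hubbardGridSub L M β (2 * (2 * M))) (y, ((ω, σ), c)) ((q, σ), c)‖ =
      1 / (|β| * (L : ℝ) ^ 2) *
        ‖∑ k : FreqMomentum L M, F ω k *
          (if c = 0 then
              torusChar (fun _ : Fin 1 => ((k.1 : ℕ) : ZMod (2 * (2 * M))))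
                  (fun _ : Fin 1 => ((q.1 : ℕ) : ZMod (2 * (2 * M))) - 2 * ((y.1 : ℕ) : ZMod (2 * (2 * M)))) *
                torusChar k.2 (q.2 - y.2)
            else
              conj (torusChar (fun _ : Fin 1 => ((k.1 : ℕ) : ZMod (2 * (2 * M))))
                  (fun _ : Fin 1 => ((q.1 : ℕ) : ZMod (2 * (2 * M))) - 2 * ((y.1 : ℕ) : ZMod (2 * (2 * M)))) *
                torusChar k.2 (q.2 - y.2)))‖ := by
  rw [sectorAnalysis_mul_hubbardGridSub_apply_eq_char hβ, norm_mul, norm_mul]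
  have hu : ‖(if c = 0 then Complex.exp (((π * (1 - 2 * M) * (((q.1 : ℕ) : ℝ) - 2 * ((y.1 : ℕ) : ℝ)) / (2 * (2 * M)) : ℝ) : ℂ) * I)
      else conj (Complex.exp (((π * (1 - 2 * M) * (((q.1 : ℕ) : ℝ) - 2 * ((y.1 : ℕ) : ℝ)) / (2 * (2 * M)) : ℝ) : ℂ) * I)))‖ = 1 := by
    split_ifs
    · exact Complex.norm_exp_ofReal_mul_I _
    · rw [Complex.norm_conj]; exact Complex.norm_exp_ofReal_mul_I _
  rw [hu, one_mul]
  congr 1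
  rw [Complex.norm_real, Real.norm_eq_abs, abs_div, abs_one, abs_mul, abs_pow, Nat.abs_cast]

/-! ### Row sums: the whole product torus, whatever the row -/

/-- `j' ↦ (j' mod 4M)` is a bijection `Fin (4M) → ℤ/4Mℤ`. [folklore] -/
private theorem bijective_gridIdxToZMod (Ng : ℕ) [NeZero Ng] :
    Function.Bijective fun j' : Fin Ng => ((j' : ℕ) : ZMod Ng) := by
  have hinj : Function.Injective fun j' : Fin Ng => ((j' : ℕ) : ZMod Ng) := by
    intro a b h
    have hv := congr_arg ZMod.val h
    simp only [ZMod.val_natCast, Nat.mod_eq_of_lt a.isLt, Nat.mod_eq_of_lt b.isLt] at hv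
    exact Fin.ext hv
  refine (Fintype.bijective_iff_injective_and_card _).2 ⟨hinj, ?_⟩
  rw [Fintype.card_fin, ZMod.card]

/-- **Every row sum of `‖E_F S_{4M}‖` is the product-torus sum**: for every row `(y, ((ω,σ),c))`,
`Σ_{q} ‖(E_F S)((y,((ω,σ),c)),((q,σ),c))‖ = (|β|L²)⁻¹ Σ_{(d,w) ∈ ℤ/4Mℤ × (ℤ/Lℤ)²} ‖Σ_k F_ω(k) Χ_c(k; d, w)‖` — independent of `y`
(the column index `q ↦ (q₀ - 2y₀, q⃗ - y⃗)` sweeps the product torus exactly once). [cite: BenfattoGiulianiMastropietro2006, §2.7 (2.71a)] -/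
theorem rowSum_norm_sectorAnalysis_mul_hubbardGridSub_eq [NeZero M] {β : ℝ} (hβ : β ≠ 0) (F : Fin N → FreqMomentum L M → ℂ)
    (y : SpaceTimeIdx L M) (ω : Fin N) (σ c : Fin 2) :
    ∑ q : GridPoint L (2 * (2 * M)), ‖(sectorAnalysisMatrix L M β F * hubbardGridSub L M β (2 * (2 * M))) (y, ((ω, σ), c)) ((q, σ), c)‖ =
      1 / (|β| * (L : ℝ) ^ 2) *
        ∑ dw : TorusSite 1 (2 * (2 * M)) × TorusSite 2 L, ‖∑ k : FreqMomentum L M, F ω k *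
          (if c = 0 then torusChar (fun _ : Fin 1 => ((k.1 : ℕ) : ZMod (2 * (2 * M)))) dw.1 * torusChar k.2 dw.2
            else conj (torusChar (fun _ : Fin 1 => ((k.1 : ℕ) : ZMod (2 * (2 * M)))) dw.1 * torusChar k.2 dw.2))‖ := by
  haveI : NeZero (2 * (2 * M)) := ⟨by have := NeZero.ne M; omega⟩
  simp_rw [norm_sectorAnalysis_mul_hubbardGridSub_apply hβ]
  rw [← mul_sum]
  congr 1
  -- `q ↦ (q₀ - 2y₀, q⃗ - y⃗)` is a bijection onto the product torus
  refine Fintype.sum_bijective (fun q : GridPoint L (2 * (2 * M)) =>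
      ((fun _ : Fin 1 => ((q.1 : ℕ) : ZMod (2 * (2 * M))) - 2 * ((y.1 : ℕ) : ZMod (2 * (2 * M))), q.2 - y.2) :
        TorusSite 1 (2 * (2 * M)) × TorusSite 2 L)) ?_ _ _ fun _ => rfl
  refine (Fintype.bijective_iff_injective_and_card _).2 ⟨fun q q' hqq => ?_, ?_⟩
  · have h1 := congr_fun (congr_arg Prod.fst hqq) 0
    have h2 := congr_arg Prod.snd hqq
    simp only [sub_left_inj] at h1 h2
    exact Prod.ext ((bijective_gridIdxToZMod (2 * (2 * M))).1 h1) h2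
  · simp only [Fintype.card_prod, Fintype.card_fin, Fintype.card_pi, Fin.prod_const, ZMod.card, pow_one]

/-! ### Column sums: at most the product torus -/

/-- **Every column sum of `‖E_F S_{4M}‖` is at most the product-torus sum**: for every column `((q,σ),c)` and sector `ω`,
`Σ_{y} ‖(E_F S)((y,((ω,σ),c)),((q,σ),c))‖ ≤ (|β|L²)⁻¹ Σ_{(d,w)} ‖Σ_k F_ω(k) Χ_c(k; d, w)‖` (the dual-lattice rows `y ↦ (q₀ - 2y₀, q⃗ - y⃗)`
are distinct points of the product torus). [cite: BenfattoGiulianiMastropietro2006, §2.7 (2.71a)] -/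
theorem colSum_norm_sectorAnalysis_mul_hubbardGridSub_le [NeZero M] {β : ℝ} (hβ : β ≠ 0) (F : Fin N → FreqMomentum L M → ℂ)
    (q : GridPoint L (2 * (2 * M))) (ω : Fin N) (σ c : Fin 2) :
    ∑ y : SpaceTimeIdx L M, ‖(sectorAnalysisMatrix L M β F * hubbardGridSub L M β (2 * (2 * M))) (y, ((ω, σ), c)) ((q, σ), c)‖ ≤
      1 / (|β| * (L : ℝ) ^ 2) *
        ∑ dw : TorusSite 1 (2 * (2 * M)) × TorusSite 2 L, ‖∑ k : FreqMomentum L M, F ω k *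
          (if c = 0 then torusChar (fun _ : Fin 1 => ((k.1 : ℕ) : ZMod (2 * (2 * M)))) dw.1 * torusChar k.2 dw.2
            else conj (torusChar (fun _ : Fin 1 => ((k.1 : ℕ) : ZMod (2 * (2 * M)))) dw.1 * torusChar k.2 dw.2))‖ := by
  classical
  haveI : NeZero (2 * (2 * M)) := ⟨by have := NeZero.ne M; omega⟩
  simp_rw [norm_sectorAnalysis_mul_hubbardGridSub_apply hβ]
  rw [← mul_sum]
  refine mul_le_mul_of_nonneg_left ?_ (by positivity)
  -- `y ↦ (q₀ - 2y₀, q⃗ - y⃗)` is injective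
  set g : SpaceTimeIdx L M → TorusSite 1 (2 * (2 * M)) × TorusSite 2 L := fun y =>
    ((fun _ : Fin 1 => ((q.1 : ℕ) : ZMod (2 * (2 * M))) - 2 * ((y.1 : ℕ) : ZMod (2 * (2 * M))), q.2 - y.2)) with hg
  set f : TorusSite 1 (2 * (2 * M)) × TorusSite 2 L → ℝ := fun dw => ‖∑ k : FreqMomentum L M, F ω k *
    (if c = 0 then torusChar (fun _ : Fin 1 => ((k.1 : ℕ) : ZMod (2 * (2 * M)))) dw.1 * torusChar k.2 dw.2
      else conj (torusChar (fun _ : Fin 1 => ((k.1 : ℕ) : ZMod (2 * (2 * M)))) dw.1 * torusChar k.2 dw.2))‖ with hf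
  have hinj : Function.Injective g := by
    intro y y' hyy
    have h1 := congr_fun (congr_arg Prod.fst hyy) 0
    have h2 := congr_arg Prod.snd hyy
    simp only [hg, sub_right_inj] at h1 h2
    refine Prod.ext ?_ h2
    -- `2y₀ = 2y₀'` in `ℤ/4Mℤ` with `y₀, y₀' < 2M`
    have hv := congr_arg ZMod.val h1
    have hy : 2 * (y.1 : ℕ) < 2 * (2 * M) := by have := y.1.isLt; omega
    have hy' : 2 * (y'.1 : ℕ) < 2 * (2 * M) := by have := y'.1.isLt; omega
    have e1 : (2 * ((y.1 : ℕ) : ZMod (2 * (2 * M)))).val = 2 * (y.1 : ℕ) := by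
      rw [show (2 : ZMod (2 * (2 * M))) * ((y.1 : ℕ) : ZMod (2 * (2 * M))) = ((2 * (y.1 : ℕ) : ℕ) : ZMod (2 * (2 * M))) by push_cast; rfl,
        ZMod.val_natCast, Nat.mod_eq_of_lt hy]
    have e2 : (2 * ((y'.1 : ℕ) : ZMod (2 * (2 * M)))).val = 2 * (y'.1 : ℕ) := by
      rw [show (2 : ZMod (2 * (2 * M))) * ((y'.1 : ℕ) : ZMod (2 * (2 * M))) = ((2 * (y'.1 : ℕ) : ℕ) : ZMod (2 * (2 * M))) by push_cast; rfl,
        ZMod.val_natCast, Nat.mod_eq_of_lt hy']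
    rw [e1, e2] at hv
    exact Fin.ext (by omega)
  calc ∑ y : SpaceTimeIdx L M, f (g y) = ∑ dw ∈ univ.image g, f dw := by
        rw [sum_image fun y _ y' _ h => hinj h]
    _ ≤ ∑ dw, f dw := sum_le_sum_of_subset_of_nonneg (subset_univ _) fun _ _ _ => norm_nonneg _

/-! ### The `cr`/`cc` hypotheses of the representation theorems from ONE product-torus bound -/

/-- **`cr` from the product-torus sums**: if for every sector `ω` and charge `c`
`(|β|L²)⁻¹ Σ_{(d,w)} ‖Σ_k F_ω(k) Χ_c(k; d, w)‖ ≤ T`, then every row of `E_F S_{4M}` has `Σ_q ‖·‖ ≤ T`.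
[cite: BenfattoGiulianiMastropietro2006, §2.7 (2.71a)] -/
theorem rowSum_sectorAnalysis_mul_hubbardGridSub_le_of_torusSum [NeZero M] {β : ℝ} (hβ : β ≠ 0)
    (F : Fin N → FreqMomentum L M → ℂ) {T : ℝ}
    (hT : ∀ (ω : Fin N) (c : Fin 2), 1 / (|β| * (L : ℝ) ^ 2) *
        ∑ dw : TorusSite 1 (2 * (2 * M)) × TorusSite 2 L, ‖∑ k : FreqMomentum L M, F ω k *
          (if c = 0 then torusChar (fun _ : Fin 1 => ((k.1 : ℕ) : ZMod (2 * (2 * M)))) dw.1 * torusChar k.2 dw.2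
            else conj (torusChar (fun _ : Fin 1 => ((k.1 : ℕ) : ZMod (2 * (2 * M)))) dw.1 * torusChar k.2 dw.2))‖ ≤ T)
    (ω : Fin N) (σ c : Fin 2) (y : SpaceTimeIdx L M) :
    ∑ q : GridPoint L (2 * (2 * M)),
      ‖(sectorAnalysisMatrix L M β F * hubbardGridSub L M β (2 * (2 * M))) (y, ((ω, σ), c)) ((q, σ), c)‖ ≤ T := by
  rw [rowSum_norm_sectorAnalysis_mul_hubbardGridSub_eq hβ]
  exact hT ω c

/-- **`cc` from the product-torus sums**: under the same bound, every column of `E_F S_{4M}` has `Σ_ω Σ_y ‖·‖ ≤ N·T`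
(`N` = number of sectors). [cite: BenfattoGiulianiMastropietro2006, §2.7 (2.71a)] -/
theorem colSum_sectorAnalysis_mul_hubbardGridSub_le_of_torusSum [NeZero M] {β : ℝ} (hβ : β ≠ 0)
    (F : Fin N → FreqMomentum L M → ℂ) {T : ℝ}
    (hT : ∀ (ω : Fin N) (c : Fin 2), 1 / (|β| * (L : ℝ) ^ 2) *
        ∑ dw : TorusSite 1 (2 * (2 * M)) × TorusSite 2 L, ‖∑ k : FreqMomentum L M, F ω k *
          (if c = 0 then torusChar (fun _ : Fin 1 => ((k.1 : ℕ) : ZMod (2 * (2 * M)))) dw.1 * torusChar k.2 dw.2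
            else conj (torusChar (fun _ : Fin 1 => ((k.1 : ℕ) : ZMod (2 * (2 * M)))) dw.1 * torusChar k.2 dw.2))‖ ≤ T)
    (σ c : Fin 2) (q : GridPoint L (2 * (2 * M))) :
    ∑ ω : Fin N, ∑ y : SpaceTimeIdx L M,
      ‖(sectorAnalysisMatrix L M β F * hubbardGridSub L M β (2 * (2 * M))) (y, ((ω, σ), c)) ((q, σ), c)‖ ≤ N * T := by
  calc _ ≤ ∑ _ω : Fin N, T := sum_le_sum fun ω _ => (colSum_norm_sectorAnalysis_mul_hubbardGridSub_le hβ F q ω σ c).trans (hT ω c)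
    _ = N * T := by rw [sum_const, card_univ, Fintype.card_fin, nsmul_eq_mul]

end Literature.MathematicalPhysics.QuantumLattice

end
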